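import Summits.AtomisticToContinuum.HydrodynamicLimit.Theorems.CollisionIsometryCLTMacroClosureStubLedgerScaling
import Literature.MathematicalPhysics.KineticTheory.HardSphereBBGKYLiouvilleFlow
import Mathlib.MeasureTheory.Integral.Pi

/-!
# The squeeze `SqueezeToBlockGibbs` (route JaynesSqueeze), III: conditionally Gaussian velocities at time zero

Helper file (`--supports stmt-AtomisticToContinuum-13463`) for the support item `SqueezeToBlockGibbs` of route
`JaynesSqueeze`. Under the local Gibbs law `λ_N = localGibbsLaw σ a₀ u₀ θ₀ N Φ` (continuous positive profiles,
`σ ≤ 1/2`) the velocities are, conditionally on the positions, independent Gaussians `N(u₀(xᵢ), θ₀(xᵢ))`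
(`lintegral_localGibbsMeasure`). Consequences used by the squeeze:

* `integral_velFluct_localGibbsLaw` — the EXACT equipartition identity
  `E_λ[(N+1)⁻¹ Σᵢ |vᵢ − u₀(xᵢ)|²/θ₀(xᵢ)] = 3` (and integrability of that observable);
* `integral_logPair_localGibbsLaw` — the mean of the empirical log-profile pairing splits into two position
  one-body means and the constant `−3/2`:
  `E_λ⟨emp, log prof₀⟩ = E_λ[ρ̂(log a₀)] + E_λ[ρ̂(log (2πθ₀)^{-3/2})] − 3/2`;
* `integrable_kineticPair_localGibbsLaw`, `integrable_kineticPair_flow_localGibbsLaw` — the kinetic energy pairing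
  `⟨emp z, |v|²⟩` is `λ_N`-integrable at time `0` and, by conservation of the kinetic energy along the hard-sphere
  flow (`HardSphereFlow.configEnergy_flow`), through `Φ_t` at every time `t` (the hypotheses `hK0`, `hKt` of the
  transport identities).

References: Spohn 1991 Part I §2.3; Olla–Varadhan–Yau 1993 §3.
-/

noncomputable section

open MeasureTheory Filter Set Topology
open scoped ENNReal

namespace Summit.AtomisticToContinuum.HydrodynamicLimit.Theorems.JaynesSqueezeSqueeze

open Literature.MathematicalPhysics.KineticTheory Literature.Analysis.FluidPDE
open Literature.Analysis.FunctionSpaces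
open MacroClosureLine.StubLedger

/-! ## Gaussian equipartition -/

/-- `E |v − u|²/θ = dim` under `N(u, θ)` on `ℝ³` (`θ > 0`). [folklore] -/
theorem integral_norm_sub_sq_div_gaussMeasure (u : V3) {θ : ℝ} (hθ : 0 < θ) :
    ∫ v, ‖v - u‖ ^ 2 / θ ∂gaussMeasure u θ = 3 := by
  rw [integral_gaussMeasure u hθ]
  have hpt : ∀ w : V3, ‖u + Real.sqrt θ • w - u‖ ^ 2 / θ = ‖w‖ ^ 2 := by
    intro w
    rw [add_sub_cancel_left, norm_smul, Real.norm_eq_abs, abs_of_nonneg (Real.sqrt_nonneg θ), mul_pow,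
      Real.sq_sqrt hθ.le]
    field_simp
  simp_rw [hpt]
  rw [integral_norm_sq_stdGaussian]
  simp

/-- `|v − u|²/θ` is integrable under `N(u, θ)` (`θ > 0`). [folklore] -/
theorem integrable_norm_sub_sq_div_gaussMeasure (u : V3) {θ : ℝ} (hθ : 0 < θ) :
    Integrable (fun v : V3 => ‖v - u‖ ^ 2 / θ) (gaussMeasure u θ) := by
  have hpt : ∀ w : V3, ‖u + Real.sqrt θ • w - u‖ ^ 2 / θ = ‖w‖ ^ 2 := by
    intro w
    rw [add_sub_cancel_left, norm_smul, Real.norm_eq_abs, abs_of_nonneg (Real.sqrt_nonneg θ), mul_pow,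
      Real.sq_sqrt hθ.le]
    field_simp
  rw [gaussMeasure, ← coe_gaussShiftEquiv u hθ]
  refine (integrable_map_equiv (gaussShiftEquiv u hθ) _).2 ?_
  have : ((fun v : V3 => ‖v - u‖ ^ 2 / θ) ∘ (gaussShiftEquiv u hθ)) = fun w => ‖w‖ ^ 2 := by
    funext w
    simp only [Function.comp_apply, coe_gaussShiftEquiv, hpt]
  rw [this]
  exact integrable_norm_sq_stdGaussian

/-- Equipartition for the product velocity law given the positions:
`∫ Σᵢ |vᵢ − u₀(xᵢ)|²/θ₀(xᵢ) d(⊗ᵢ N(u₀(xᵢ), θ₀(xᵢ))) = 3(N+1)`. [folklore] -/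
theorem integral_sum_velFluct_velMeasure {u₀ : T3 → V3} {θ₀ : T3 → ℝ} (hθ0 : ∀ x, 0 < θ₀ x) {N : ℕ}
    (x : Fin (N + 1) → T3) :
    Integrable (fun v : Fin (N + 1) → V3 => ∑ i, ‖v i - u₀ (x i)‖ ^ 2 / θ₀ (x i)) (velMeasure u₀ θ₀ x) ∧
      ∫ v, (∑ i, ‖v i - u₀ (x i)‖ ^ 2 / θ₀ (x i)) ∂velMeasure u₀ θ₀ x = 3 * ((N : ℝ) + 1) := by
  have hint : ∀ i : Fin (N + 1), Integrable (fun v : Fin (N + 1) → V3 => ‖v i - u₀ (x i)‖ ^ 2 / θ₀ (x i))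
      (velMeasure u₀ θ₀ x) := fun i =>
    integrable_comp_eval (μ := fun j => gaussMeasure (u₀ (x j)) (θ₀ (x j)))
      (f := fun w : V3 => ‖w - u₀ (x i)‖ ^ 2 / θ₀ (x i)) (integrable_norm_sub_sq_div_gaussMeasure _ (hθ0 _))
  refine ⟨integrable_finsetSum _ fun i _ => hint i, ?_⟩
  rw [integral_finsetSum _ fun i _ => hint i]
  have hterm : ∀ i : Fin (N + 1),
      ∫ v, ‖v i - u₀ (x i)‖ ^ 2 / θ₀ (x i) ∂velMeasure u₀ θ₀ x = 3 := by
    intro i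
    rw [velMeasure, integral_comp_eval (μ := fun j => gaussMeasure (u₀ (x j)) (θ₀ (x j)))
      (f := fun w : V3 => ‖w - u₀ (x i)‖ ^ 2 / θ₀ (x i)) (by fun_prop)]
    exact integral_norm_sub_sq_div_gaussMeasure _ (hθ0 _)
  simp only [hterm, Finset.sum_const, Finset.card_univ, Fintype.card_fin, nsmul_eq_mul]
  push_cast
  ring

/-! ## Equipartition under the local Gibbs law -/

/-- The normalised velocity fluctuation `(N+1)⁻¹ Σᵢ |vᵢ − u₀(xᵢ)|²/θ₀(xᵢ)` is measurable. [folklore] -/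
theorem measurable_velFluct {u₀ : T3 → V3} {θ₀ : T3 → ℝ} (hu : Continuous u₀) (hθ : Continuous θ₀) (N : ℕ) :
    Measurable fun z : Config (N + 1) (Fin 3) T3 =>
      ((N : ℝ) + 1)⁻¹ * ∑ i, ‖(z i).2 - u₀ (z i).1‖ ^ 2 / θ₀ (z i).1 := by
  refine measurable_const.mul (Finset.measurable_sum _ fun i _ => ?_)
  exact (((measurable_pi_apply i).snd.sub (hu.measurable.comp (measurable_pi_apply i).fst)).norm.pow_const 2).div
    (hθ.measurable.comp (measurable_pi_apply i).fst)

/-- **Exact equipartition under the local Gibbs law.** For continuous profiles `a₀, θ₀ > 0`, `u₀` and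
`σ ≤ 1/2`: the observable `(N+1)⁻¹ Σᵢ |vᵢ − u₀(xᵢ)|²/θ₀(xᵢ)` is `λ_N`-integrable with mean `3`
(conditionally on the positions the velocities are independent `N(u₀(xᵢ), θ₀(xᵢ))`). [folklore] -/
theorem integral_velFluct_localGibbsLaw {σ : ℝ} (hσ2 : σ ≤ 1 / 2) {a₀ θ₀ : T3 → ℝ} {u₀ : T3 → V3}
    (ha : Continuous a₀) (hθ : Continuous θ₀) (hu : Continuous u₀) (ha0 : ∀ x, 0 < a₀ x) (hθ0 : ∀ x, 0 < θ₀ x)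
    (N : ℕ) (Φ : HardSphereFlow (Torus.geometry (Fin 3)) (hsDiameter σ N) (N + 1)) :
    Integrable (fun z : Config (N + 1) (Fin 3) T3 => ((N : ℝ) + 1)⁻¹ * ∑ i, ‖(z i).2 - u₀ (z i).1‖ ^ 2 / θ₀ (z i).1)
        (localGibbsLaw σ a₀ u₀ θ₀ N Φ) ∧
      ∫ z, ((N : ℝ) + 1)⁻¹ * ∑ i, ‖(z i).2 - u₀ (z i).1‖ ^ 2 / θ₀ (z i).1 ∂(localGibbsLaw σ a₀ u₀ θ₀ N Φ) = 3 := by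
  haveI := isProbabilityMeasure_localGibbsMeasure ha hθ hu ha0 hθ0 hσ2 N
  set F : Config (N + 1) (Fin 3) T3 → ℝ := fun z =>
    ((N : ℝ) + 1)⁻¹ * ∑ i, ‖(z i).2 - u₀ (z i).1‖ ^ 2 / θ₀ (z i).1 with hF
  have hFm : Measurable F := measurable_velFluct hu hθ N
  have hF0 : ∀ z, 0 ≤ F z := fun z => mul_nonneg (inv_nonneg.2 (by positivity))
    (Finset.sum_nonneg fun i _ => div_nonneg (sq_nonneg _) (hθ0 _).le)
  -- the conditional (velocity) integral, uniformly in the positions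
  have hvel : ∀ x : Fin (N + 1) → T3, ∫⁻ v, ENNReal.ofReal (F (zipConfig (x, v))) ∂velMeasure u₀ θ₀ x = ENNReal.ofReal 3 := by
    intro x
    obtain ⟨hint, hval⟩ := integral_sum_velFluct_velMeasure (u₀ := u₀) hθ0 x
    have hFx : ∀ v : Fin (N + 1) → V3, F (zipConfig (x, v)) = ((N : ℝ) + 1)⁻¹ * ∑ i, ‖v i - u₀ (x i)‖ ^ 2 / θ₀ (x i) := by
      intro v; simp [hF, zipConfig_apply]
    simp_rw [hFx]
    rw [← ofReal_integral_eq_lintegral_ofReal (hint.const_mul _)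
      (Eventually.of_forall fun v => mul_nonneg (inv_nonneg.2 (by positivity))
        (Finset.sum_nonneg fun i _ => div_nonneg (sq_nonneg _) (hθ0 _).le)), integral_const_mul, hval]
    congr 1
    field_simp
  have hlint : ∫⁻ z, ENNReal.ofReal (F z) ∂(localGibbsLaw σ a₀ u₀ θ₀ N Φ) = ENNReal.ofReal 3 := by
    rw [localGibbsLaw_eq, lintegral_localGibbsMeasure ha hθ hu (fun x => (ha0 x).le) hθ0 σ N hFm.ennreal_ofReal]
    simp_rw [hvel]
    have hρm : Measurable fun x : Fin (N + 1) → T3 => ENNReal.ofReal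
        ((canonicalPartition (Torus.geometry (Fin 3)) (hsDiameter σ N) (N + 1)
          (localGibbsProfile a₀ u₀ θ₀))⁻¹ * posWeight a₀ (hsDiameter σ N) (N + 1) x) :=
      (measurable_const.mul (measurable_posWeight ha _ _)).ennreal_ofReal
    rw [lintegral_mul_const _ hρm, lintegral_posWeight_eq_one ha hθ hu (fun x => (ha0 x).le) hθ0 σ N, one_mul]
  have hInt : Integrable F (localGibbsLaw σ a₀ u₀ θ₀ N Φ) := by
    refine ⟨hFm.aestronglyMeasurable, ?_⟩
    rw [hasFiniteIntegral_iff_ofReal (Eventually.of_forall hF0), hlint]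
    exact ENNReal.ofReal_lt_top
  refine ⟨hInt, ?_⟩
  rw [integral_eq_lintegral_of_nonneg_ae (Eventually.of_forall hF0) hFm.aestronglyMeasurable, hlint,
    ENNReal.toReal_ofReal (by norm_num)]

/-! ## The mean of the log-profile pairing -/

/-- **The mean of the empirical log-profile pairing under its own local Gibbs law** splits into two position
one-body means and the equipartition constant:
`E_λ⟨emp, log prof₀⟩ = E_λ[ρ̂(log a₀)] + E_λ[ρ̂(x ↦ log (2πθ₀(x))^{-3/2})] − 3/2`, where `ρ̂(χ)` is the
empirical density field tested against `χ`. [folklore] -/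
theorem integral_logPair_localGibbsLaw {σ : ℝ} (hσ2 : σ ≤ 1 / 2) {a₀ θ₀ : T3 → ℝ} {u₀ : T3 → V3}
    (ha : Continuous a₀) (hθ : Continuous θ₀) (hu : Continuous u₀) (ha0 : ∀ x, 0 < a₀ x) (hθ0 : ∀ x, 0 < θ₀ x)
    (N : ℕ) (Φ : HardSphereFlow (Torus.geometry (Fin 3)) (hsDiameter σ N) (N + 1)) :
    ∫ z, (∫ y, Real.log (localGibbsProfile a₀ u₀ θ₀ y) ∂(empiricalMeasure z)) ∂(localGibbsLaw σ a₀ u₀ θ₀ N Φ) =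
      (∫ z, empiricalDensityField z (fun x => Real.log (a₀ x)) ∂(localGibbsLaw σ a₀ u₀ θ₀ N Φ)) +
        (∫ z, empiricalDensityField z
            (fun x => Real.log ((2 * Real.pi * θ₀ x) ^ (-(Module.finrank ℝ V3 : ℝ) / 2)))
          ∂(localGibbsLaw σ a₀ u₀ θ₀ N Φ)) - 3 / 2 := by
  haveI := isProbabilityMeasure_localGibbsLaw ha hθ hu ha0 hθ0 hσ2 N Φ
  -- pointwise splitting of the pairing
  have hpt : ∀ z : Config (N + 1) (Fin 3) T3,
      (∫ y, Real.log (localGibbsProfile a₀ u₀ θ₀ y) ∂(empiricalMeasure z)) =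
        empiricalDensityField z (fun x => Real.log (a₀ x)) +
          empiricalDensityField z (fun x => Real.log ((2 * Real.pi * θ₀ x) ^ (-(Module.finrank ℝ V3 : ℝ) / 2))) -
          2⁻¹ * (((N : ℝ) + 1)⁻¹ * ∑ i, ‖(z i).2 - u₀ (z i).1‖ ^ 2 / θ₀ (z i).1) := by
    intro z
    rw [logPair_eq_sum, empiricalDensityField_eq_sum, empiricalDensityField_eq_sum]
    have hlog : ∀ i : Fin (N + 1), Real.log (localGibbsProfile a₀ u₀ θ₀ (z i)) =
        Real.log (a₀ (z i).1) + Real.log ((2 * Real.pi * θ₀ (z i).1) ^ (-(Module.finrank ℝ V3 : ℝ) / 2)) -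
          ‖(z i).2 - u₀ (z i).1‖ ^ 2 / (2 * θ₀ (z i).1) := fun i =>
      log_localGibbsProfile_eq (z i).1 (z i).2 (ha0 _) (hθ0 _)
    simp_rw [hlog]
    push_cast
    simp only [Finset.mul_sum, Finset.sum_add_distrib, Finset.sum_sub_distrib, mul_add, mul_sub]
    congr 1
    refine Finset.sum_congr rfl fun i _ => ?_
    ring
  -- integrability of the three pieces
  obtain ⟨C₁, -, hC₁⟩ := exists_forall_abs_le_of_continuous (ha.log fun x => (ha0 x).ne')
  have hRc : Continuous fun x => (2 * Real.pi * θ₀ x) ^ (-(Module.finrank ℝ V3 : ℝ) / 2) :=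
    (continuous_const.mul hθ).rpow_const fun x => Or.inl (mul_pos (mul_pos two_pos Real.pi_pos) (hθ0 x)).ne'
  have hRlog : Continuous fun x => Real.log ((2 * Real.pi * θ₀ x) ^ (-(Module.finrank ℝ V3 : ℝ) / 2)) :=
    hRc.log fun x => (Real.rpow_pos_of_pos (mul_pos (mul_pos two_pos Real.pi_pos) (hθ0 x)) _).ne'
  obtain ⟨C₂, -, hC₂⟩ := exists_forall_abs_le_of_continuous hRlog
  have hbdd : ∀ {χ : T3 → ℝ} (hχ : Continuous χ) {C : ℝ} (hC : ∀ x, |χ x| ≤ C),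
      Integrable (fun z : Config (N + 1) (Fin 3) T3 => empiricalDensityField z χ) (localGibbsLaw σ a₀ u₀ θ₀ N Φ) := by
    intro χ hχ C hC
    have hm : Measurable fun z : Config (N + 1) (Fin 3) T3 => empiricalDensityField z χ := by
      simp_rw [empiricalDensityField_eq_sum]
      exact measurable_const.mul (Finset.measurable_sum _ fun i _ => hχ.measurable.comp (measurable_pi_apply i).fst)
    refine (integrable_const C).mono' hm.aestronglyMeasurable (ae_of_all _ fun z => ?_)
    rw [Real.norm_eq_abs, empiricalDensityField_eq_sum, abs_mul, abs_of_nonneg (by positivity)]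
    push_cast
    calc ((N : ℝ) + 1)⁻¹ * |∑ i, χ (z i).1| ≤ ((N : ℝ) + 1)⁻¹ * ∑ i : Fin (N + 1), C := by
          refine mul_le_mul_of_nonneg_left ((Finset.abs_sum_le_sum_abs _ _).trans
            (Finset.sum_le_sum fun i _ => hC _)) (by positivity)
      _ = C := by
          rw [Finset.sum_const, Finset.card_univ, Fintype.card_fin, nsmul_eq_mul]; push_cast; field_simp
  have hI₁ := hbdd (ha.log fun x => (ha0 x).ne') hC₁
  have hI₂ := hbdd hRlog hC₂
  obtain ⟨hI₃, hval⟩ := integral_velFluct_localGibbsLaw hσ2 ha hθ hu ha0 hθ0 N Φ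
  simp_rw [hpt]
  have hI12 : Integrable (fun z : Config (N + 1) (Fin 3) T3 => empiricalDensityField z (fun x => Real.log (a₀ x)) +
      empiricalDensityField z (fun x => Real.log ((2 * Real.pi * θ₀ x) ^ (-(Module.finrank ℝ V3 : ℝ) / 2))))
      (localGibbsLaw σ a₀ u₀ θ₀ N Φ) := hI₁.add hI₂
  have hI3' : Integrable (fun z : Config (N + 1) (Fin 3) T3 =>
      2⁻¹ * (((N : ℝ) + 1)⁻¹ * ∑ i, ‖(z i).2 - u₀ (z i).1‖ ^ 2 / θ₀ (z i).1)) (localGibbsLaw σ a₀ u₀ θ₀ N Φ) :=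
    hI₃.const_mul _
  rw [integral_sub hI12 hI3', integral_add hI₁ hI₂, integral_const_mul, hval]
  ring

/-! ## Integrability of the kinetic energy pairing at times `0` and `t` -/

/-- **The kinetic energy pairing is integrable under the local Gibbs law** (continuous profiles, `σ ≤ 1/2`):
`|v|² ≤ 2|v − u₀(x)|² + 2|u₀(x)|²` and equipartition. [folklore] -/
theorem integrable_kineticPair_localGibbsLaw {σ : ℝ} (hσ2 : σ ≤ 1 / 2) {a₀ θ₀ : T3 → ℝ} {u₀ : T3 → V3}
    (ha : Continuous a₀) (hθ : Continuous θ₀) (hu : Continuous u₀) (ha0 : ∀ x, 0 < a₀ x) (hθ0 : ∀ x, 0 < θ₀ x)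
    (N : ℕ) (Φ : HardSphereFlow (Torus.geometry (Fin 3)) (hsDiameter σ N) (N + 1)) :
    Integrable (fun z => ∫ y, ‖y.2‖ ^ 2 ∂(empiricalMeasure z)) (localGibbsLaw σ a₀ u₀ θ₀ N Φ) := by
  haveI := isProbabilityMeasure_localGibbsLaw ha hθ hu ha0 hθ0 hσ2 N Φ
  obtain ⟨Θ, -, hΘ⟩ := exists_forall_abs_le_of_continuous hθ
  obtain ⟨U, -, hU⟩ := exists_forall_abs_le_of_continuous hu.norm
  obtain ⟨hI, -⟩ := integral_velFluct_localGibbsLaw hσ2 ha hθ hu ha0 hθ0 N Φ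
  have hm : Measurable fun z : Config (N + 1) (Fin 3) T3 => ∫ y, ‖y.2‖ ^ 2 ∂(empiricalMeasure z) := by
    simp_rw [kineticPair_eq_sum]
    exact measurable_const.mul (Finset.measurable_sum _ fun i _ => (measurable_pi_apply i).snd.norm.pow_const 2)
  refine ((hI.const_mul (2 * Θ)).add (integrable_const (2 * U ^ 2))).mono' hm.aestronglyMeasurable
    (ae_of_all _ fun z => ?_)
  rw [Real.norm_eq_abs, kineticPair_eq_sum, abs_of_nonneg (by positivity)]
  -- termwise: `|vᵢ|² ≤ 2Θ |vᵢ - u|²/θ + 2U²`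
  have hterm : ∀ i : Fin (N + 1), ‖(z i).2‖ ^ 2 ≤
      2 * Θ * (‖(z i).2 - u₀ (z i).1‖ ^ 2 / θ₀ (z i).1) + 2 * U ^ 2 := by
    intro i
    have hθi := hθ0 (z i).1
    have hΘi : θ₀ (z i).1 ≤ Θ := (le_abs_self _).trans (hΘ _)
    have hUi : ‖u₀ (z i).1‖ ≤ U := by simpa using hU (z i).1
    have h1 : ‖(z i).2‖ ≤ ‖(z i).2 - u₀ (z i).1‖ + ‖u₀ (z i).1‖ := norm_le_norm_sub_add _ _
    have h2 : ‖(z i).2‖ ^ 2 ≤ 2 * ‖(z i).2 - u₀ (z i).1‖ ^ 2 + 2 * ‖u₀ (z i).1‖ ^ 2 := by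
      nlinarith [h1, sq_nonneg (‖(z i).2 - u₀ (z i).1‖ - ‖u₀ (z i).1‖), norm_nonneg ((z i).2),
        norm_nonneg ((z i).2 - u₀ (z i).1), norm_nonneg (u₀ (z i).1)]
    have h3 : ‖(z i).2 - u₀ (z i).1‖ ^ 2 ≤ Θ * (‖(z i).2 - u₀ (z i).1‖ ^ 2 / θ₀ (z i).1) := by
      rw [mul_div_assoc', le_div_iff₀ hθi]
      exact mul_comm Θ _ ▸ mul_le_mul_of_nonneg_left hΘi (sq_nonneg _)
    have h4 : ‖u₀ (z i).1‖ ^ 2 ≤ U ^ 2 := by gcongr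
    linarith
  calc ((N : ℝ) + 1)⁻¹ * ∑ i, ‖(z i).2‖ ^ 2
      ≤ ((N : ℝ) + 1)⁻¹ * ∑ i, (2 * Θ * (‖(z i).2 - u₀ (z i).1‖ ^ 2 / θ₀ (z i).1) + 2 * U ^ 2) :=
        mul_le_mul_of_nonneg_left (Finset.sum_le_sum fun i _ => hterm i) (by positivity)
    _ = 2 * Θ * (((N : ℝ) + 1)⁻¹ * ∑ i, ‖(z i).2 - u₀ (z i).1‖ ^ 2 / θ₀ (z i).1) + 2 * U ^ 2 := by
        rw [Finset.sum_add_distrib, Finset.sum_const, Finset.card_univ, Fintype.card_fin, nsmul_eq_mul,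
          ← Finset.mul_sum]
        push_cast
        field_simp
    _ = _ := by simp only [Pi.add_apply]

/-- The kinetic energy pairing is `(N+1)⁻¹ · 2E(z)`. [folklore] -/
theorem kineticPair_eq_configEnergy {N : ℕ} (z : Config (N + 1) (Fin 3) T3) :
    ∫ y, ‖y.2‖ ^ 2 ∂(empiricalMeasure z) = ((N : ℝ) + 1)⁻¹ * (2 * configEnergy z) := by
  rw [kineticPair_eq_sum, configEnergy]
  congr 1
  ring

/-- **The kinetic energy pairing through the flow is integrable at every time**: it equals the time-zero pairing
almost surely (conservation of the kinetic energy along the hard-sphere flow on its good set, which carries the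
local Gibbs law). [folklore] -/
theorem integrable_kineticPair_flow_localGibbsLaw {σ : ℝ} (hσ2 : σ ≤ 1 / 2) {a₀ θ₀ : T3 → ℝ} {u₀ : T3 → V3}
    (ha : Continuous a₀) (hθ : Continuous θ₀) (hu : Continuous u₀) (ha0 : ∀ x, 0 < a₀ x) (hθ0 : ∀ x, 0 < θ₀ x)
    (N : ℕ) (Φ : HardSphereFlow (Torus.geometry (Fin 3)) (hsDiameter σ N) (N + 1)) (t : ℝ) :
    Integrable (fun z => ∫ y, ‖y.2‖ ^ 2 ∂(empiricalMeasure (Φ.flow t z))) (localGibbsLaw σ a₀ u₀ θ₀ N Φ) := by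
  have h0 := integrable_kineticPair_localGibbsLaw hσ2 ha hθ hu ha0 hθ0 N Φ
  have hm : Measurable fun z : Config (N + 1) (Fin 3) T3 => ∫ y, ‖y.2‖ ^ 2 ∂(empiricalMeasure (Φ.flow t z)) := by
    have h1 : Measurable fun z : Config (N + 1) (Fin 3) T3 => ∫ y, ‖y.2‖ ^ 2 ∂(empiricalMeasure z) := by
      simp_rw [kineticPair_eq_sum]
      exact measurable_const.mul (Finset.measurable_sum _ fun i _ => (measurable_pi_apply i).snd.norm.pow_const 2)
    exact h1.comp (Φ.measurable_flow t)
  refine h0.congr' hm.aestronglyMeasurable ?_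
  have hac : localGibbsLaw σ a₀ u₀ θ₀ N Φ ≪ liouville (Torus.geometry (Fin 3)) (N + 1) (hsDiameter σ N) := by
    rw [localGibbsLaw, particleLaw_eq]; exact withDensity_absolutelyContinuous _ _
  filter_upwards [hac.ae_le Φ.ae_mem_good] with z hz
  rw [kineticPair_eq_configEnergy, kineticPair_eq_configEnergy, Φ.configEnergy_flow hz t]

end Summit.AtomisticToContinuum.HydrodynamicLimit.Theorems.JaynesSqueezeSqueeze

end
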